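import Summits.KontsevichZagierPeriods.KontsevichZagierPeriods.Theorems.HurwitzMicroSectorsNormalFormPrincipleM4KernelRefs
import Summits.KontsevichZagierPeriods.KontsevichZagierPeriods.Theorems.MzvKernelInKZ.Negative.ScalingDivision
import Summits.KontsevichZagierPeriods.KontsevichZagierPeriods.Theorems.HyperbolicBlochOffTetraSectorKernelStubAffineOrbit
import Summits.KontsevichZagierPeriods.KontsevichZagierPeriods.Theorems.HurwitzMicroSectorsNormalFormPrincipleM4LevelOneFromLevelTwo
import Summits.KontsevichZagierPeriods.KontsevichZagierPeriods.Theorems.HurwitzMicroSectorsNormalFormPrincipleM4RelBstuffle22pp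

/-!
# `NormalFormPrinciple` (stmt-KontsevichZagierPeriods-3869), line `SketchIdeator1` —
# leaf `stub_boxRigidity`, layer `M4`: the level-two box `[□⁴, 1/((1+xy)(1−Π))]` (`13ζ(4)/16`) joins the kernel

Pure proof file (lead seat c9; `--supports` the crux). Exact linear algebra on the thirteen landed
level-two rows shows that the alternating word `acab` is already pinned: `16[acab] − 3[aaab] = 8·bst22pp − k5`
(`m4_level2_acab`). Consequences: (1) the census pair of a genuinely LEVEL-TWO nested box against the
`ζ(4)` box, `16·[□⁴, 1/((1 + x₀x₁)(1 − Π))] ∼ 13·[□⁴, 1/(1 − Π)]` (`m4_etaTwoZeta_box`; value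
`13ζ(4)/16 = Σ_{m>n≥1} (−1)^{n−1}/(m²n²)… read as a box`), by the cubical chart and the split
`1/(t(1+t)) = 1/t − 1/(1+t)`; (2) in the companion file `…PiPowersKernelEta.lean` the family joins the `π`-powers kernel.
References: M. Kontsevich, D. Zagier, *Periods* (2001), §1.2. No definitions are introduced.
-/

noncomputable section

open MeasureTheory Set
open Literature.NumberTheory.Transcendental Literature.NumberTheory.Transcendental.KZ
open Literature.ModelTheory.ExponentialFields (IsSemialgebraic)
open Summit.KontsevichZagierPeriods.MzvKernelInKZ.Negative (mem_relations_of_nsmul_mem)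
open Summit.KontsevichZagierPeriods.HyperbolicBloch.OffTetraSectorKernel
  (aff_orbit_of_sub_sum_zsmul_mem_relations)

namespace Summit.KontsevichZagierPeriods.HurwitzMicroSectors.NormalFormPrinciple.PiBox.M3

/-- **`16[acab] − 3[aaab] ∈ KZ.relations`** for arbitrary carriers of the words `ac` (on `Δ₂`),
`aaab`, `acab` (on `Δ₄`): `8·([ac]·[ac] − [aaab] + 2[acab]) − (8[ac]·[ac] − 5[aaab])`, the box-stuffle
`m4_rel_bstuffle22pp` against the words-level relation `k5` of `m4_weightFour_mzv_levelTwo` (the other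
carriers that theorem wants are supplied internally). [cite: KontsevichZagier2001, §1.2 rules (1), (2)] -/
theorem m4_level2_acab (AC : IntegralRep 2) (hACd : AC.domain = {t | 0 < t 1 ∧ t 1 < t 0 ∧ t 0 < 1})
    (hACi : AC.integrand = fun t => 1 / t 0 * (1 / (1 + t 1)))
    (AAAB : IntegralRep 4) (hAAABd : AAAB.domain = {t | 0 < t 3 ∧ t 3 < t 2 ∧ t 2 < t 1 ∧ t 1 < t 0 ∧ t 0 < 1})
    (hAAABi : AAAB.integrand = fun t => 1 / t 0 * (1 / t 1) * (1 / t 2) * (1 / (1 - t 3)))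
    (ACAB : IntegralRep 4) (hACABd : ACAB.domain = {t | 0 < t 3 ∧ t 3 < t 2 ∧ t 2 < t 1 ∧ t 1 < t 0 ∧ t 0 < 1})
    (hACABi : ACAB.integrand = fun t => 1 / t 0 * (1 / (1 + t 1)) * (1 / t 2) * (1 / (1 - t 3))) :
    (16:ℤ) • of ACAB - (3:ℤ) • of AAAB ∈ relations := by
  obtain ⟨C1, hC1d, hC1i⟩ := m4b_exists_logBox
  obtain ⟨AB, hABd, hABi⟩ : ∃ T : IntegralRep 2, T.domain = {t | 0 < t 1 ∧ t 1 < t 0 ∧ t 0 < 1} ∧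
      (T.integrand = fun t => 1 / t 0 * (1 / (1 - t 1))) :=
    m4t_exists_wordRep2 (fun u => 1 / u) (fun u => 1 / (1 - u)) (Or.inl rfl) (Or.inl rfl)
  obtain ⟨AAB, -, AAC, -, -, -, -, -, -, -, -, -, -, -, -, -, ⟨hAABd, hAABi⟩, -, ⟨hAACd, hAACi⟩, -⟩ :=
    l2w3_carriers
  obtain ⟨AAAC, hAAACd, hAAACi⟩ : ∃ T : IntegralRep 4, T.domain = {t | 0 < t 3 ∧ t 3 < t 2 ∧ t 2 < t 1 ∧ t 1 < t 0 ∧ t 0 < 1} ∧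
      (T.integrand = fun t => 1 / t 0 * (1 / t 1) * (1 / t 2) * (1 / (1 + t 3))) :=
    m4_exists_wordRep4 (fun u => 1 / u) (fun u => 1 / u) (fun u => 1 / u) (fun u => 1 / (1 + u)) (Or.inl rfl) (Or.inl rfl) (Or.inl rfl) (Or.inr rfl)
  obtain ⟨AABB, hAABBd, hAABBi⟩ : ∃ T : IntegralRep 4, T.domain = {t | 0 < t 3 ∧ t 3 < t 2 ∧ t 2 < t 1 ∧ t 1 < t 0 ∧ t 0 < 1} ∧
      (T.integrand = fun t => 1 / t 0 * (1 / t 1) * (1 / (1 - t 2)) * (1 / (1 - t 3))) :=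
    m4_exists_wordRep4 (fun u => 1 / u) (fun u => 1 / u) (fun u => 1 / (1 - u)) (fun u => 1 / (1 - u)) (Or.inl rfl) (Or.inl rfl) (Or.inr (Or.inl rfl)) (Or.inl rfl)
  obtain ⟨AABC, hAABCd, hAABCi⟩ : ∃ T : IntegralRep 4, T.domain = {t | 0 < t 3 ∧ t 3 < t 2 ∧ t 2 < t 1 ∧ t 1 < t 0 ∧ t 0 < 1} ∧
      (T.integrand = fun t => 1 / t 0 * (1 / t 1) * (1 / (1 - t 2)) * (1 / (1 + t 3))) :=
    m4_exists_wordRep4 (fun u => 1 / u) (fun u => 1 / u) (fun u => 1 / (1 - u)) (fun u => 1 / (1 + u)) (Or.inl rfl) (Or.inl rfl) (Or.inr (Or.inl rfl)) (Or.inr rfl)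
  obtain ⟨AACB, hAACBd, hAACBi⟩ : ∃ T : IntegralRep 4, T.domain = {t | 0 < t 3 ∧ t 3 < t 2 ∧ t 2 < t 1 ∧ t 1 < t 0 ∧ t 0 < 1} ∧
      (T.integrand = fun t => 1 / t 0 * (1 / t 1) * (1 / (1 + t 2)) * (1 / (1 - t 3))) :=
    m4_exists_wordRep4 (fun u => 1 / u) (fun u => 1 / u) (fun u => 1 / (1 + u)) (fun u => 1 / (1 - u)) (Or.inl rfl) (Or.inl rfl) (Or.inr (Or.inr rfl)) (Or.inl rfl)
  obtain ⟨AACC, hAACCd, hAACCi⟩ : ∃ T : IntegralRep 4, T.domain = {t | 0 < t 3 ∧ t 3 < t 2 ∧ t 2 < t 1 ∧ t 1 < t 0 ∧ t 0 < 1} ∧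
      (T.integrand = fun t => 1 / t 0 * (1 / t 1) * (1 / (1 + t 2)) * (1 / (1 + t 3))) :=
    m4_exists_wordRep4 (fun u => 1 / u) (fun u => 1 / u) (fun u => 1 / (1 + u)) (fun u => 1 / (1 + u)) (Or.inl rfl) (Or.inl rfl) (Or.inr (Or.inr rfl)) (Or.inr rfl)
  obtain ⟨ABAB, hABABd, hABABi⟩ : ∃ T : IntegralRep 4, T.domain = {t | 0 < t 3 ∧ t 3 < t 2 ∧ t 2 < t 1 ∧ t 1 < t 0 ∧ t 0 < 1} ∧
      (T.integrand = fun t => 1 / t 0 * (1 / (1 - t 1)) * (1 / t 2) * (1 / (1 - t 3))) :=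
    m4_exists_wordRep4 (fun u => 1 / u) (fun u => 1 / (1 - u)) (fun u => 1 / u) (fun u => 1 / (1 - u)) (Or.inl rfl) (Or.inr (Or.inl rfl)) (Or.inl rfl) (Or.inl rfl)
  obtain ⟨ABAC, hABACd, hABACi⟩ : ∃ T : IntegralRep 4, T.domain = {t | 0 < t 3 ∧ t 3 < t 2 ∧ t 2 < t 1 ∧ t 1 < t 0 ∧ t 0 < 1} ∧
      (T.integrand = fun t => 1 / t 0 * (1 / (1 - t 1)) * (1 / t 2) * (1 / (1 + t 3))) :=
    m4_exists_wordRep4 (fun u => 1 / u) (fun u => 1 / (1 - u)) (fun u => 1 / u) (fun u => 1 / (1 + u)) (Or.inl rfl) (Or.inr (Or.inl rfl)) (Or.inl rfl) (Or.inr rfl)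
  obtain ⟨ACAC, hACACd, hACACi⟩ : ∃ T : IntegralRep 4, T.domain = {t | 0 < t 3 ∧ t 3 < t 2 ∧ t 2 < t 1 ∧ t 1 < t 0 ∧ t 0 < 1} ∧
      (T.integrand = fun t => 1 / t 0 * (1 / (1 + t 1)) * (1 / t 2) * (1 / (1 + t 3))) :=
    m4_exists_wordRep4 (fun u => 1 / u) (fun u => 1 / (1 + u)) (fun u => 1 / u) (fun u => 1 / (1 + u)) (Or.inl rfl) (Or.inr (Or.inr rfl)) (Or.inl rfl) (Or.inr rfl)
  obtain ⟨CAAB, hCAABd, hCAABi⟩ : ∃ T : IntegralRep 4, T.domain = {t | 0 < t 3 ∧ t 3 < t 2 ∧ t 2 < t 1 ∧ t 1 < t 0 ∧ t 0 < 1} ∧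
      (T.integrand = fun t => 1 / (1 + t 0) * (1 / t 1) * (1 / t 2) * (1 / (1 - t 3))) :=
    m4_exists_wordRep4 (fun u => 1 / (1 + u)) (fun u => 1 / u) (fun u => 1 / u) (fun u => 1 / (1 - u)) (Or.inr rfl) (Or.inl rfl) (Or.inl rfl) (Or.inl rfl)
  obtain ⟨CAAC, hCAACd, hCAACi⟩ : ∃ T : IntegralRep 4, T.domain = {t | 0 < t 3 ∧ t 3 < t 2 ∧ t 2 < t 1 ∧ t 1 < t 0 ∧ t 0 < 1} ∧
      (T.integrand = fun t => 1 / (1 + t 0) * (1 / t 1) * (1 / t 2) * (1 / (1 + t 3))) :=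
    m4_exists_wordRep4 (fun u => 1 / (1 + u)) (fun u => 1 / u) (fun u => 1 / u) (fun u => 1 / (1 + u)) (Or.inr rfl) (Or.inl rfl) (Or.inl rfl) (Or.inr rfl)
  obtain ⟨-, -, -, -, k5⟩ := m4_weightFour_mzv_levelTwo C1 hC1d hC1i AB hABd hABi AC hACd hACi AAB hAABd hAABi AAC hAACd hAACi AAAB hAAABd hAAABi AAAC hAAACd hAAACi AABB hAABBd hAABBi AABC hAABCd hAABCi AACB hAACBd hAACBi AACC hAACCd hAACCi ABAB hABABd hABABi ABAC hABACd hABACi ACAB hACABd hACABi ACAC hACACd hACACi CAAB hCAABd hCAABi CAAC hCAACd hCAACi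
  have b4 := m4_rel_bstuffle22pp AC hACd hACi AAAB hAAABd hAAABi ACAB hACABd hACABi
  have e : (16:ℤ) • of ACAB - (3:ℤ) • of AAAB =
      (8:ℤ) • (of (AC.prod AC) - of AAAB + (2:ℤ) • of ACAB) -
        ((8:ℤ) • of (AC.prod AC) - (5:ℤ) • of AAAB) := by
    simp only [smul_sub, smul_add, smul_smul]; norm_num; abel
  rw [e]
  exact relations.sub_mem (relations.zsmul_mem b4 _) k5

/-- **A carrier of `1/(t₀t₁(1+t₁)t₂(1−t₃))` on `Δ₄` and its split `aaab − acab`.** [cite: KontsevichZagier2001, §1.2 rule (1)] -/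
theorem m4e_exists_V (AAAB : IntegralRep 4) (hAAABd : AAAB.domain = {t | 0 < t 3 ∧ t 3 < t 2 ∧ t 2 < t 1 ∧ t 1 < t 0 ∧ t 0 < 1})
    (hAAABi : AAAB.integrand = fun t => 1 / t 0 * (1 / t 1) * (1 / t 2) * (1 / (1 - t 3)))
    (ACAB : IntegralRep 4) (hACABd : ACAB.domain = {t | 0 < t 3 ∧ t 3 < t 2 ∧ t 2 < t 1 ∧ t 1 < t 0 ∧ t 0 < 1})
    (hACABi : ACAB.integrand = fun t => 1 / t 0 * (1 / (1 + t 1)) * (1 / t 2) * (1 / (1 - t 3))) :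
    ∃ V : IntegralRep 4, V.domain = {t | 0 < t 3 ∧ t 3 < t 2 ∧ t 2 < t 1 ∧ t 1 < t 0 ∧ t 0 < 1} ∧
      (V.integrand = fun t => 1 / (t 0 * t 1 * (1 + t 1) * t 2 * (1 - t 3))) ∧
      of V - ((1:ℤ) • of AAAB + (-1:ℤ) • of ACAB) ∈ relations := by
  have hIa : IntegrableOn (fun t : Fin 4 → ℝ => 1 / t 0 * (1 / t 1) * (1 / t 2) * (1 / (1 - t 3)))
      {t : Fin 4 → ℝ | 0 < t 3 ∧ t 3 < t 2 ∧ t 2 < t 1 ∧ t 1 < t 0 ∧ t 0 < 1} := by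
    have h := AAAB.integrableOn; rw [hAAABd, hAAABi] at h; exact h
  have hFG : ∀ t ∈ {t : Fin 4 → ℝ | 0 < t 3 ∧ t 3 < t 2 ∧ t 2 < t 1 ∧ t 1 < t 0 ∧ t 0 < 1},
      1 / (t 0 * t 1 * (1 + t 1) * t 2 * (1 - t 3)) =
        1 / t 0 * (1 / t 1) * (1 / t 2) * (1 / (1 - t 3)) -
          1 / t 0 * (1 / (1 + t 1)) * (1 / t 2) * (1 / (1 - t 3)) := fun t ht => by
    obtain ⟨h0, h1, h11, h2, h21, h31⟩ := m4z_simplex_facts ht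
    have : 0 < 1 + t 1 := by linarith
    field_simp
    ring
  obtain ⟨V, hVd, hVi⟩ : ∃ T : IntegralRep 4, T.domain = {t | 0 < t 3 ∧ t 3 < t 2 ∧ t 2 < t 1 ∧ t 1 < t 0 ∧ t 0 < 1} ∧
      T.integrand = fun t => 1 / (t 0 * t 1 * (1 + t 1) * t 2 * (1 - t 3)) := by
    have hq : ∀ t ∈ {t : Fin 4 → ℝ | 0 < t 3 ∧ t 3 < t 2 ∧ t 2 < t 1 ∧ t 1 < t 0 ∧ t 0 < 1},
        (MvPolynomial.aeval t (MvPolynomial.X 0 * MvPolynomial.X 1 * (1 + MvPolynomial.X 1) *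
          MvPolynomial.X 2 * (1 - MvPolynomial.X 3) : MvPolynomial (Fin 4) ℚ) : ℝ) ≠ 0 := by
      intro t ht
      obtain ⟨h0, h1, h11, h2, h21, h31⟩ := m4z_simplex_facts ht
      simp only [map_mul, map_add, map_sub, map_one, MvPolynomial.aeval_X]
      positivity
    refine m4s_exists_rep_of_abs_le ((isSemialgebraicFunOn_aeval_div_aeval
      m4s_isSemialgebraic_simplex4 1 _ hq).congr fun t _ => by
        simp only [map_mul, map_add, map_sub, map_one, MvPolynomial.aeval_X]) ?_ hIa
      fun t ht => ?_
    · exact continuousOn_const.div (by fun_prop) fun t ht => by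
        obtain ⟨h0, h1, h11, h2, h21, h31⟩ := m4z_simplex_facts ht
        positivity
    · obtain ⟨h0, h1, h11, h2, h21, h31⟩ := m4z_simplex_facts ht
      rw [abs_of_pos (by positivity)]
      rw [div_le_iff₀ (by positivity)]
      have e : 1 / t 0 * (1 / t 1) * (1 / t 2) * (1 / (1 - t 3)) * (t 0 * t 1 * (1 + t 1) * t 2 * (1 - t 3))
          = 1 + t 1 := by field_simp
      rw [e]; linarith
  refine ⟨V, hVd, hVi, ?_⟩
  have h := aff_orbit_of_sub_sum_zsmul_mem_relations (Finset.univ : Finset (Fin 2))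
    ![AAAB, ACAB] ![1, -1] V (fun i _ => by
      fin_cases i
      · exact hAAABd.trans hVd.symm
      · exact hACABd.trans hVd.symm) fun t ht => ?_
  · simpa [Fin.sum_univ_two] using h
  rw [hVi]
  simp only [Fin.sum_univ_two, Matrix.cons_val_zero, Matrix.cons_val_one, hAAABi, hACABi]
  push_cast
  rw [one_mul, neg_one_mul, ← sub_eq_add_neg]
  exact hFG t (hVd ▸ ht)

/-- **`16·[□⁴, 1/((1+xy)(1−Π))] ∼ 13·[□⁴, 1/(1−Π)]`** (lead seat c9, line `SketchIdeator1`, layer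
`M4`): a level-two nested box of dimension four against the `ζ(4)` box (`(13/16)ζ(4)`), through the
thirteen level-two relations of the campaign. [cite: KontsevichZagier2001, §1.2 rules (1), (2)] -/
theorem m4_etaTwoZeta_box :
    ∀ (r r' : IntegralRep 4), r.domain = {x | ∀ i, x i ∈ Set.Ioo (0:ℝ) 1} →
      EqOn r.integrand (fun x => 16 / ((1 + x 0 * x 1) * (1 - x 0 * x 1 * x 2 * x 3))) r.domain →
      r'.domain = {x | ∀ i, x i ∈ Set.Ioo (0:ℝ) 1} →
      EqOn r'.integrand (fun x => 13 / (1 - x 0 * x 1 * x 2 * x 3)) r'.domain →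
      Equivalent r r' := by
  intro r r' hrd hri hr'd hr'i
  obtain ⟨C1, hC1d, hC1i⟩ := m4b_exists_logBox
  obtain ⟨-, AC, -, -, AAAB, -, -, -, -, ⟨hACd, hACi⟩, -, -, ⟨hAAABd, hAAABi⟩, -, -, -, -, -, -, -, -,
    -, -⟩ := m4r4_exists_words C1 hC1d hC1i
  obtain ⟨ACAB, hACABd, hACABi⟩ : ∃ T : IntegralRep 4, T.domain = {t | 0 < t 3 ∧ t 3 < t 2 ∧ t 2 < t 1 ∧ t 1 < t 0 ∧ t 0 < 1} ∧
      (T.integrand = fun t => 1 / t 0 * (1 / (1 + t 1)) * (1 / t 2) * (1 / (1 - t 3))) :=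
    m4_exists_wordRep4 (fun u => 1 / u) (fun u => 1 / (1 + u)) (fun u => 1 / u) (fun u => 1 / (1 - u))
      (Or.inl rfl) (Or.inr (Or.inr rfl)) (Or.inl rfl) (Or.inl rfl)
  have k := m4_level2_acab AC hACd hACi AAAB hAAABd hAAABi ACAB hACABd hACABi
  obtain ⟨V, hVd, hVi, hVsplit⟩ := m4e_exists_V AAAB hAAABd hAAABi ACAB hACABd hACABi
  have c1 : of r - (16:ℕ) • of V ∈ relations := by
    refine m4z_box_sub_nsmul_word 16 _ r V hrd hVd hVi fun x hx => ?_
    rw [hrd] at hx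
    obtain ⟨h0, h1, h2, h3, h01, -, hP⟩ := m4z_box_facts hx
    rw [hri (hrd ▸ hx)]
    simp only [Matrix.cons_val_zero, Matrix.cons_val_one, Matrix.head_cons, Matrix.cons_val_two,
      Matrix.tail_cons, Matrix.cons_val_three]
    have hP' : 1 - x 0 * x 1 * x 2 * x 3 ≠ 0 := by linarith
    push_cast
    field_simp
  have c2 : of r' - (13:ℕ) • of AAAB ∈ relations := by
    refine m4z_box_sub_nsmul_word 13 _ r' AAAB hr'd hAAABd hAAABi fun x hx => ?_
    rw [hr'd] at hx
    obtain ⟨h0, h1, h2, h3, -, -, hP⟩ := m4z_box_facts hx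
    rw [hr'i (hr'd ▸ hx)]
    simp only [Matrix.cons_val_zero, Matrix.cons_val_one, Matrix.head_cons, Matrix.cons_val_two,
      Matrix.tail_cons, Matrix.cons_val_three]
    have hP' : 1 - x 0 * x 1 * x 2 * x 3 ≠ 0 := by linarith
    push_cast
    field_simp
  show of r - of r' ∈ relations
  have e : of r - of r' = (of r - (16:ℕ) • of V) + (16:ℕ) • (of V - ((1:ℤ) • of AAAB + (-1:ℤ) • of ACAB))
      - ((16:ℤ) • of ACAB - (3:ℤ) • of AAAB) - (of r' - (13:ℕ) • of AAAB) := by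
    simp only [one_smul, neg_smul, smul_add, smul_sub, smul_neg]
    abel
  rw [e]
  exact relations.sub_mem (relations.sub_mem (relations.add_mem c1 (relations.nsmul_mem hVsplit _)) k) c2

end Summit.KontsevichZagierPeriods.HurwitzMicroSectors.NormalFormPrinciple.PiBox.M3
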